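import Summits.BirchSwinnertonDyer.Rank1Residual.X12.ClassClosureO10Readings
import Summits.BirchSwinnertonDyer.Rank1Residual.Additive.QuadraticBranchPeriodRatioOfManinFact
import HarnessLib

/-!
# O10-PS class node of record with NO displayed analytic datum: `hper` REPLACED by the named fact
# `mazur_not_dvd_maninConstant_of_odd` (Mazur 1978 Cor. 4.1) through x1b's `Additive.periodRatio_of_mazur`
# (cell `bsd-cm`, seat `bsd-cm-inert` g7; TARGET.md R248 = RULING D58 (4), x1b INBOX 18:32Z [130];
# item N17″; bookkeeping over the tree's theorems; nothing asserted, nothing booked)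

HONEST FRAMING (cell `bsd-cm`, run/shared/lean/pub/bsd-cm/): FULL BSD for every analytic-rank `≤ 1`
curve is the programme's target of record. The O10-PS class node of record v3
(`X12.O10.lowerHalfOnType_IstarZero_of_valuation_of_lowerReading`, `X12/ClassClosureO10Readings.lean`,
p402929) displays ONE analytic datum `hper`: for every good `a_p = 0` curve `V` at `p` with newform
`f`, a rational `ϖ` with `‖ϖ‖_p ≤ 1` and `ϖ·Ω_V = Ω⁺_f` (`p ≡ 1 (mod 4)`) resp. `ϖ·|Ω⁻(V)| = Ω⁻_f`
(`p ≡ 3 (mod 4)`). On the sibling cell `b2b-bsdres` (x1b file 130, CITED not re-derived) BOTH cases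
are ONE TERM from the EXISTING named Literature fact `hM : mazur_not_dvd_maninConstant_of_odd`
(Mazur 1978 Cor. 4.1 in its lattice form: for an optimal parametrisation datum at level `N'` and an odd
`p` with `p² ∤ N'`, `p ∤ c`): the plus side through `SkinnerUrban2014.realPeriodRat_eq_unit_mul_plusPeriod_of_mazur`,
the minus side through `SkinnerUrban2014.imaginaryPeriodRat_eq_unit_mul_minusPeriod_of_mazur`
(Greenberg–Vatsal 2000 §3 Rem. 3.4 for both periods, PROVED in the tree modulo `hM`; irreducibility at
a good `a_p = 0` prime by Serre 1972 §1.11 Prop. 12) — `Additive.periodRatio_of_mazur p hM hp5` =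
VERBATIM `hper`. This file wires that term into the class node, its `BSD_p` pair form and the
lower-half pair form: the O10-PS node then reads «`LowerHalfOnType p I₀*` ⟸ C-cc-1 on the type ∧
(C1_η) on the CM good-inert twins ∧ named facts {`hmod`, `hGZ`, `hGZK`, `hPT`, `hnf`, `hM`} ∧ the lower
reading `h74l`» — NO displayed analytic or Manin datum left, at EVERY `p ≥ 5` (both parities, the
`j = 1728` pairs included). A sibling file, not an append, only because the node file sits at 378 of
the tree's 400 lines. All conjecture inputs are typed `@[conjecture]`s (C-cc-1
`QuadraticBranchPAdicGrossZagierValuationAt`, OUR conjecture, in no source; (C1_η)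
`QuadraticBranchPlusMainConjectureAt`, conjecture in print) — NOT claimed; `hM` is a named fact taken
as a hypothesis (statement only in the tree); nothing booked; no label / mark / count moves; O10
stays OPEN at class level («no CLASS-level treatment in print», D46 (2)).

References (locators only): [Mazur1978] Cor. 4.1; [GreenbergVatsal2000] §3 Rem. 3.4;
[EdixhovenManin1991] Prop. 2; [Serre1972] §1.11 Prop. 12; [Kobayashi2003] Thm. 3.2 (p. 7), §4 (p. 8),
Thm. 7.4 (p. 13); [KitajimaOtsuki2018] Main Thm. 1.3; [Miller2011LMS] §1, Def. 1.1.
-/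

noncomputable section

open scoped Classical MatrixGroups ModularForm NumberField

open CongruenceSubgroup Field WeierstrassCurve Literature.NumberTheory.EllipticCurves
  Literature.NumberTheory.EllipticCurves.ModularForms
  Literature.NumberTheory.EllipticCurves.Kobayashi2003
  Literature.NumberTheory.EllipticCurves.Rank1Residual
  Literature.NumberTheory.EllipticCurves.Rank1Residual.Typed
  Literature.NumberTheory.GaloisRepresentations Literature.NumberTheory.GaloisCohomology
  Summit.BirchSwinnertonDyer.Rank1Residual.Additive

namespace Summit.BirchSwinnertonDyer.Rank1Residual.X12.O10

variable {p : ℕ} [hp : Fact p.Prime]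

/-- **THE O10-PS NODE OF RECORD with NO displayed analytic or Manin datum: `LowerHalfOnType p I₀*`,
`p ≥ 5`** ⟸ C-cc-1 on every rank-one CM curve of signed type `(p, I₀*)` (`hIn`) ∧ (C1_η) on the CM
good-inert curves (`hC1`) ∧ the named facts `hmod hGZ hGZK hPT hnf` and
`hM : mazur_not_dvd_maninConstant_of_odd` (Mazur 1978 Cor. 4.1) ∧ the LOWER reading of Kobayashi 7.4
(ii) at `η` on the type (`h74l`). The node v3's `hper` is the one term `Additive.periodRatio_of_mazur`
(x1b file 130: Greenberg–Vatsal Rem. 3.4 for Ω⁺ and Ω⁻, proved modulo `hM`). CONDITIONAL on typed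
conjecture items, named facts and a print reading; nothing booked; no label moves; O10 stays OPEN at
class level. [cite: Mazur1978, Cor. 4.1] [cite: GreenbergVatsal2000, §3, Remark 3.4]
[cite: Kobayashi2003, §4 (p. 8), Thm. 7.4 (p. 13), Thm. 3.2 (p. 7)] [cite: Miller2011LMS, Def. 1.1] -/
theorem lowerHalfOnType_IstarZero_of_valuation_of_lowerReading_of_mazur
    (hmod : hasEntireLFunction_rat) (hGZ : GrossZagier1986_thm_I_7_3)
    (hGZK : rank_eq_analyticRank_of_analyticRank_le_one)
    (hPT : poitouTate_selmerStructure_duality_real ℚ) (hnf : exists_isNewformOf)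
    (hM : mazur_not_dvd_maninConstant_of_odd)
    (hIn : ∀ (W : WeierstrassCurve ℚ) [W.IsElliptic] [W.IsGloballyMinimal],
      HasSignedLocalType W p (.Istar 0) → W.analyticRank = 1 →
        QuadraticBranchPAdicGrossZagierValuationAt W p)
    (h74l : ∀ (W : WeierstrassCurve ℚ) [W.IsElliptic] [W.IsGloballyMinimal],
      HasSignedLocalType W p (.Istar 0) → W.analyticRank = 1 →
      ∀ (V : WeierstrassCurve ℚ) [V.IsElliptic] [V.IsGloballyMinimal] (C : VariableChange ℚ)
        {N : ℕ} [NeZero N] {f : CuspForm (Gamma0 N) 2},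
        p ≠ 2 → C • W.quadraticTwist ((-1) ^ (p / 2) * p) = V →
        V.HasGoodReductionAtPrime p → V.frobeniusTrace p = 0 →
        QuadraticBranchPlusMainConjectureAt V p → IsNewformOf V f →
        ∀ (ϖ : ℚ), (if Even (p / 2) then (ϖ : ℝ) * V.realPeriodRat = plusPeriod f
            else (ϖ : ℝ) * V.imaginaryPeriodRat = minusPeriod f) →
        ∀ (Lη : IwasawaAlgebra p), IsQuadraticBranchMinusLFunction f p ϖ Lη →
        ∀ (κ : ZpExtension ℚ p) (γ : Field.absoluteGaloisGroup ℚ),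
          κ.IsCyclotomic → κ.IsTopGenerator γ → IsCyclotomicVariable p γ →
        ∀ (D : StrictSignedSelmerDualData W κ ℚ_[p] γ (-1)) (L' : IwasawaAlgebra p),
          Lη = PowerSeries.X * L' → D.charIdeal ≤ Ideal.span {L'})
    (hC1 : ∀ (V : WeierstrassCurve ℚ) [V.IsElliptic] [V.IsGloballyMinimal], V.HasCM →
      V.HasGoodReductionAtPrime p → CMInert V p → QuadraticBranchPlusMainConjectureAt V p)
    (hp5 : 5 ≤ p) : LowerHalfOnType p (.Istar 0) :=
  lowerHalfOnType_IstarZero_of_valuation_of_lowerReading hmod hGZ hGZK hPT hnf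
    (periodRatio_of_mazur p hM hp5) hIn h74l hC1 hp5

/-- **`BSD(W, p)` for a rank-one CM curve of signed type `(p, I₀*)`, `p ≥ 5`, with NO displayed
analytic or Manin datum**: C-cc-1 (`h2`) ∧ (C1_η) on the good twins (`hC1`) ∧ named facts
`hmod hGZ hGZK hPT hnf hM` ∧ the readings `hR2` (Kitajima–Otsuki, typed) and `h74x` (exact Kobayashi
7.4 (ii) at `η`) — the node file's `bsdp_…_of_valuation_of_readings` with `hper` supplied by x1b's
term `Additive.periodRatio_of_mazur`. CONDITIONAL; nothing booked; O10 stays OPEN.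
[cite: Mazur1978, Cor. 4.1] [cite: Kobayashi2003, §4 (p. 8), Thm. 7.4 (p. 13)]
[cite: KitajimaOtsuki2018, Main Thm. 1.3 (arXiv:1607.03612 p. 3)] [cite: Miller2011LMS, §1 and Def. 1.1] -/
theorem bsdp_of_hasSignedLocalType_IstarZero_of_valuation_of_readings_of_mazur
    (hmod : hasEntireLFunction_rat) (hGZ : GrossZagier1986_thm_I_7_3)
    (hGZK : rank_eq_analyticRank_of_analyticRank_le_one)
    (hPT : poitouTate_selmerStructure_duality_real ℚ) (hnf : exists_isNewformOf)
    (hM : mazur_not_dvd_maninConstant_of_odd)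
    (hC1 : ∀ (V : WeierstrassCurve ℚ) [V.IsElliptic] [V.IsGloballyMinimal], V.HasCM →
      V.HasGoodReductionAtPrime p → CMInert V p → QuadraticBranchPlusMainConjectureAt V p)
    (W : WeierstrassCurve ℚ) [W.IsElliptic] [W.IsGloballyMinimal]
    (h2 : QuadraticBranchPAdicGrossZagierValuationAt W p)
    (hR2 : OddBranchStrictMinusNoFiniteSubmoduleAt W p)
    (h74x : ∀ (V : WeierstrassCurve ℚ) [V.IsElliptic] [V.IsGloballyMinimal] (C : VariableChange ℚ)
        {N : ℕ} [NeZero N] {f : CuspForm (Gamma0 N) 2},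
        p ≠ 2 → C • W.quadraticTwist ((-1) ^ (p / 2) * p) = V →
        V.HasGoodReductionAtPrime p → V.frobeniusTrace p = 0 →
        QuadraticBranchPlusMainConjectureAt V p → IsNewformOf V f →
        ∀ (ϖ : ℚ), (if Even (p / 2) then (ϖ : ℝ) * V.realPeriodRat = plusPeriod f
            else (ϖ : ℝ) * V.imaginaryPeriodRat = minusPeriod f) →
        ∀ (Lη : IwasawaAlgebra p), IsQuadraticBranchMinusLFunction f p ϖ Lη →
        ∀ (κ : ZpExtension ℚ p) (γ : Field.absoluteGaloisGroup ℚ),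
          κ.IsCyclotomic → κ.IsTopGenerator γ → IsCyclotomicVariable p γ →
        ∀ (D : StrictSignedSelmerDualData W κ ℚ_[p] γ (-1)) (L' : IwasawaAlgebra p),
          Lη = PowerSeries.X * L' → D.charIdeal = Ideal.span {L'})
    (hT : HasSignedLocalType W p (.Istar 0)) (hr : W.analyticRank = 1) (hp5 : 5 ≤ p) :
    BSDp W p :=
  bsdp_of_hasSignedLocalType_IstarZero_of_valuation_of_readings hmod hGZ hGZK hPT hnf
    (periodRatio_of_mazur p hM hp5) hC1 W h2 hR2 h74x
    hT hr hp5

/-- **The LOWER HALF `MissingLowerBoundAt W p` for a rank-one CM curve of signed type `(p, I₀*)`,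
`p ≥ 5`, with NO displayed analytic or Manin datum and NO Kitajima–Otsuki input**: C-cc-1 (`h2`) ∧
(C1_η) on the good twins ∧ named facts `hmod hGZ hGZK hPT hnf hM` ∧ the lower reading `h74l` only.
CONDITIONAL; nothing booked; O10 stays OPEN.
[cite: Mazur1978, Cor. 4.1] [cite: Kobayashi2003, §4 (p. 8), Thm. 7.4 (p. 13)]
[cite: Miller2011LMS, §1 and Def. 1.1] -/
theorem missingLowerBoundAt_of_hasSignedLocalType_IstarZero_of_lowerReading_of_mazur
    (hmod : hasEntireLFunction_rat) (hGZ : GrossZagier1986_thm_I_7_3)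
    (hGZK : rank_eq_analyticRank_of_analyticRank_le_one)
    (hPT : poitouTate_selmerStructure_duality_real ℚ) (hnf : exists_isNewformOf)
    (hM : mazur_not_dvd_maninConstant_of_odd)
    (hC1 : ∀ (V : WeierstrassCurve ℚ) [V.IsElliptic] [V.IsGloballyMinimal], V.HasCM →
      V.HasGoodReductionAtPrime p → CMInert V p → QuadraticBranchPlusMainConjectureAt V p)
    (W : WeierstrassCurve ℚ) [W.IsElliptic] [W.IsGloballyMinimal]
    (h2 : QuadraticBranchPAdicGrossZagierValuationAt W p)
    (h74l : ∀ (V : WeierstrassCurve ℚ) [V.IsElliptic] [V.IsGloballyMinimal] (C : VariableChange ℚ)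
        {N : ℕ} [NeZero N] {f : CuspForm (Gamma0 N) 2},
        p ≠ 2 → C • W.quadraticTwist ((-1) ^ (p / 2) * p) = V →
        V.HasGoodReductionAtPrime p → V.frobeniusTrace p = 0 →
        QuadraticBranchPlusMainConjectureAt V p → IsNewformOf V f →
        ∀ (ϖ : ℚ), (if Even (p / 2) then (ϖ : ℝ) * V.realPeriodRat = plusPeriod f
            else (ϖ : ℝ) * V.imaginaryPeriodRat = minusPeriod f) →
        ∀ (Lη : IwasawaAlgebra p), IsQuadraticBranchMinusLFunction f p ϖ Lη →
        ∀ (κ : ZpExtension ℚ p) (γ : Field.absoluteGaloisGroup ℚ),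
          κ.IsCyclotomic → κ.IsTopGenerator γ → IsCyclotomicVariable p γ →
        ∀ (D : StrictSignedSelmerDualData W κ ℚ_[p] γ (-1)) (L' : IwasawaAlgebra p),
          Lη = PowerSeries.X * L' → D.charIdeal ≤ Ideal.span {L'})
    (hT : HasSignedLocalType W p (.Istar 0)) (hr : W.analyticRank = 1) (hp5 : 5 ≤ p) :
    MissingLowerBoundAt W p :=
  missingLowerBoundAt_of_hasSignedLocalType_IstarZero_of_valuation_of_lowerReading hmod hGZ hGZK hPT
    hnf (periodRatio_of_mazur p hM hp5) hC1 W h2 h74l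
    hT hr hp5

end Summit.BirchSwinnertonDyer.Rank1Residual.X12.O10

end
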